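import Mathlib.RingTheory.PowerSeries.WeierstrassPreparation
import Mathlib.RingTheory.Henselian
import HarnessLib

/-!
# The Weierstrass preparation theorem at an arbitrary ideal of an adically complete ring

Topic `RingTheory/HenselLemma` (proofs only; no definitions, no named facts). Mathlib proves
Weierstrass DIVISION for power series over a ring `A` complete with respect to an arbitrary ideal
`I` (`PowerSeries.IsWeierstrassDivisorAt.isWeierstrassDivisionAt_div_mod`), but the Weierstrass
PREPARATION theorem (`PowerSeries.exists_isWeierstrassFactorization`: `g = f · h` with `f` a
distinguished polynomial and `h` a unit) only for complete LOCAL rings and their maximal ideal.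
Blakestad–Grant (J. Number Theory 249 (2023), Lemma 12: "By the Weierstrass Preparation theorem,
`t'` factors uniquely in `R̂⟦t⟧` as a distinguished polynomial `d(t)` times a power series
`u(t) ∈ 1 + tR̂⟦t⟧`") apply preparation over the NON-local ring `R̂` = the `p`-adic completion of
`ℤ[1/6][A₄, A₆][1/H]` with respect to the ideal `(p)`; this file supplies that generality:

* `order_map_eq_of_coeff_mem`, `isWeierstrassDivisorAt_of_coeff_mem` — a series whose
  coefficients below degree `n` lie in `I` and whose `n`-th coefficient is a unit is a Weierstrass
  divisor at `I` of Weierstrass degree `n`;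
* `isUnit_of_isWeierstrassDivisionAt_X_pow` — dividing `Xⁿ` by such a `g` (`n` its Weierstrass
  degree) gives a UNIT quotient (`I ⊆ Jac(A)` for `A` `I`-adically complete);
* `isWeierstrassFactorizationAt_of_isWeierstrassDivisionAt` and
  **`exists_isWeierstrassFactorizationAt`** — the Weierstrass preparation theorem: over an
  `I`-adically complete ring every Weierstrass divisor `g` at `I` factors as `g = f · h` with
  `f ∈ A[X]` distinguished at `I` (monic, lower coefficients in `I`) of degree the Weierstrass
  degree of `g`, and `h ∈ A⟦X⟧ˣ`;
* `IsWeierstrassFactorizationAt.unique_of_isWeierstrassDivisorAt` — uniqueness of `(f, h)`, for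
  `A` merely `I`-adically separated.

The proofs are Mathlib's local-ring proofs (`PowerSeries.IsWeierstrassDivision.isUnit_of_map_ne_zero`,
`….isWeierstrassFactorization`, `PowerSeries.IsWeierstrassFactorization.elim`, following
Washington, *Cyclotomic Fields*, Thm. 7.3) with the residue field replaced by `A ⧸ I` and the
unit criterion of a local ring replaced by `I ⊆ Jac(A)` (`IsAdicComplete.le_jacobson_bot`).

## Sources

* N. Bourbaki, *Algèbre commutative*, Ch. VII §3 no. 8, Prop. 6 (preparation over a complete
  separated local ring); the general adic form: S. Lang, *Cyclotomic Fields I and II*, Ch. 5 §2,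
  and M. O'Malley, *Trans. AMS* 172 (1972) (Weierstrass preparation over `I`-adically complete
  rings), as cited by Blakestad–Grant. [folklore]
* L. Washington, *Introduction to Cyclotomic Fields*, GTM 83, Thm. 7.3 (the proof followed by
  Mathlib). [folklore]
* C. Blakestad, D. Grant, J. Number Theory 249 (2023), Lemma 12 (the use over `R̂`, ideal `(p)`).
  [BlakestadGrant2023]
-/

namespace Literature.RingTheory.HenselLemma

open PowerSeries
open scoped Polynomial

variable {A : Type*} [CommRing A] {I : Ideal A}

/-! ### Weierstrass divisors given by their first unit coefficient -/

/-- If the coefficients of `g` below degree `n` lie in `I` and `[Xⁿ]g ∉ I`, then the reduction of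
`g` modulo `I` has order `n`. [folklore] -/
theorem order_map_eq_of_coeff_mem {g : A⟦X⟧} {n : ℕ} (hmem : ∀ i < n, coeff i g ∈ I)
    (hn : coeff n g ∉ I) : (g.map (Ideal.Quotient.mk I)).order = n := by
  refine order_eq_nat.mpr ⟨?_, fun i hi => ?_⟩
  · rwa [coeff_map, Ne, Ideal.Quotient.eq_zero_iff_mem]
  · rw [coeff_map, Ideal.Quotient.eq_zero_iff_mem]
    exact hmem i hi

/-- **A series `g = g₀ + g₁X + ⋯` with `g₀, …, g_{n-1} ∈ I` and `gₙ ∈ Aˣ` is a Weierstrass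
divisor at `I`, of Weierstrass degree `n`** (`I ≠ A`). This is the form in which the hypothesis
is met in practice (e.g. `t' = (p/H)t + ⋯ ≡ tᵖ (mod p)` in Blakestad–Grant, Lemma 12).
[folklore] -/
theorem isWeierstrassDivisorAt_of_coeff_mem {g : A⟦X⟧} {n : ℕ} (hmem : ∀ i < n, coeff i g ∈ I)
    (hunit : IsUnit (coeff n g)) (hI : I ≠ ⊤) :
    g.IsWeierstrassDivisorAt I ∧ (g.map (Ideal.Quotient.mk I)).order.toNat = n := by
  have hn : coeff n g ∉ I := fun h => hI (Ideal.eq_top_of_isUnit_mem I h hunit)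
  have hord : (g.map (Ideal.Quotient.mk I)).order.toNat = n := by
    rw [order_map_eq_of_coeff_mem hmem hn, ENat.toNat_coe]
  refine ⟨?_, hord⟩
  rw [IsWeierstrassDivisorAt, hord]
  exact hunit

/-- A Weierstrass divisor at a proper ideal has nonzero reduction. [folklore] -/
theorem map_ne_zero_of_isWeierstrassDivisorAt {g : A⟦X⟧} (hg : g.IsWeierstrassDivisorAt I)
    (hI : I ≠ ⊤) : g.map (Ideal.Quotient.mk I) ≠ 0 := by
  intro h0
  have h1 : (g.map (Ideal.Quotient.mk I)).order.toNat = 0 := by rw [h0, order_zero, ENat.toNat_top]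
  rw [IsWeierstrassDivisorAt, h1] at hg
  have hmem : coeff 0 g ∈ I := by
    have h := congr(coeff 0 $h0)
    rwa [coeff_map, map_zero, Ideal.Quotient.eq_zero_iff_mem] at h
  exact hI (Ideal.eq_top_of_isUnit_mem I hmem hg)

/-! ### The quotient of `Xⁿ` by a Weierstrass divisor of degree `n` is a unit -/

/-- **The unit.** If `A` is `I`-adically complete, `g` is a Weierstrass divisor at `I ≠ A` of
Weierstrass degree `n`, and `Xⁿ = g·q + r` with `deg r < n`, then `q ∈ A⟦X⟧ˣ`: reducing modulo
`I` and comparing coefficients of `Xⁿ` gives `ḡₙ · q̄(0) = 1`, and units lift from `A ⧸ I`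
because `I ⊆ Jac(A)`. (Mathlib's `IsWeierstrassDivision.isUnit_of_map_ne_zero` is the local
case.) [folklore] -/
theorem isUnit_of_isWeierstrassDivisionAt_X_pow [IsAdicComplete I A] {g q : A⟦X⟧} {r : A[X]}
    (hg : g.IsWeierstrassDivisorAt I) (hI : I ≠ ⊤)
    (H : (X ^ (g.map (Ideal.Quotient.mk I)).order.toNat).IsWeierstrassDivisionAt g q r I) :
    IsUnit q := by
  have hg0 := map_ne_zero_of_isWeierstrassDivisorAt hg hI
  obtain ⟨H1, H2⟩ := H
  set n := (g.map (Ideal.Quotient.mk I)).order.toNat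
  replace H2 := congr(coeff n (($H2).map (Ideal.Quotient.mk I)))
  simp_rw [map_pow, map_X, coeff_X_pow_self, map_add, map_mul, coeff_map,
    Polynomial.coeff_coe, Polynomial.coeff_eq_zero_of_degree_lt H1, map_zero, add_zero] at H2
  haveI := isLocalHom_of_le_jacobson_bot I (IsAdicComplete.le_jacobson_bot I)
  rw [isUnit_iff_constantCoeff]
  refine isUnit_of_map_unit (Ideal.Quotient.mk I) _ ?_
  rw [coeff_mul, ← Finset.sum_subset (s₁ := {(n, 0)}) (by simp) (fun p hp hnotMem ↦ ?_),
    Finset.sum_singleton, coeff_map, coeff_map, coeff_zero_eq_constantCoeff, mul_comm] at H2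
  · exact .of_mul_eq_one _ H2.symm
  · rw [coeff_of_lt_order p.1 ?_]
    · rw [zero_mul]
    · rw [← ENat.lt_lift_iff (h := order_finite_iff_ne_zero.2 hg0), ENat.lift_eq_toNat_of_lt_top]
      refine (Finset.HasAntidiagonal.antidiagonal.fst_le hp).lt_of_ne ?_
      contrapose hnotMem
      rwa [Finset.mem_singleton, Finset.HasAntidiagonal.antidiagonal_congr hp (by simp)]

/-! ### Weierstrass preparation: existence -/

/-- **From division to preparation.** With `g`, `n`, `Xⁿ = g·q + r` as above (`A` `I`-adically
complete, `I ≠ A`): `g = (Xⁿ - r) · q⁻¹` is a Weierstrass factorization at `I` — `Xⁿ - r` is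
distinguished (the low coefficients of `r` lie in `I` because those of `Xⁿ - r = g q` do) and
`q⁻¹` is a unit. (Mathlib's `IsWeierstrassDivision.isWeierstrassFactorization` is the local case.)
[folklore] -/
theorem isWeierstrassFactorizationAt_of_isWeierstrassDivisionAt [IsAdicComplete I A]
    {g q : A⟦X⟧} {r : A[X]} (hg : g.IsWeierstrassDivisorAt I) (hI : I ≠ ⊤)
    (H : (X ^ (g.map (Ideal.Quotient.mk I)).order.toNat).IsWeierstrassDivisionAt g q r I) :
    g.IsWeierstrassFactorizationAt
      (Polynomial.X ^ (g.map (Ideal.Quotient.mk I)).order.toNat - r)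
      ↑(isUnit_of_isWeierstrassDivisionAt_X_pow hg hI H).unit⁻¹ I := by
  haveI : Nontrivial A :=
    ⟨⟨1, 0, fun h10 => hI ((Ideal.eq_top_iff_one I).mpr (by rw [h10]; exact I.zero_mem))⟩⟩
  have H1 : r.degree < (g.map (Ideal.Quotient.mk I)).order.toNat := H.1
  set n := (g.map (Ideal.Quotient.mk I)).order.toNat
  set f := Polynomial.X ^ n - r
  replace H1 : r.degree < (Polynomial.X (R := A) ^ n).degree := by rwa [Polynomial.degree_X_pow]
  have hfdeg : f.natDegree = n := by
    suffices f.degree = n by rw [Polynomial.natDegree, this]; rfl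
    rw [Polynomial.degree_sub_eq_left_of_degree_lt H1, Polynomial.degree_X_pow]
  refine ⟨⟨⟨fun {i} hi ↦ ?_⟩, .sub_of_left (Polynomial.monic_X_pow _) H1⟩, Units.isUnit _, ?_⟩
  · rw [hfdeg] at hi
    simp_rw [f, Polynomial.coeff_sub, Polynomial.coeff_X_pow, if_neg hi.ne, zero_sub, neg_mem_iff]
    have := H.coeff_f_sub_r_mem hi
    rwa [map_sub, coeff_X_pow, if_neg hi.ne, zero_sub, neg_mem_iff, Polynomial.coeff_coe] at this
  · have := congr($(H.2) * ↑(isUnit_of_isWeierstrassDivisionAt_X_pow hg hI H).unit⁻¹)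
    rw [add_mul, mul_assoc, IsUnit.mul_val_inv, mul_one, ← sub_eq_iff_eq_add] at this
    simp_rw [← this, f, Polynomial.coe_sub, Polynomial.coe_pow, Polynomial.coe_X, sub_mul]

/-- **Weierstrass preparation theorem at an ideal of an adically complete ring.** Let `A` be
`I`-adically complete and `g ∈ A⟦X⟧` a Weierstrass divisor at `I ≠ A` (its first coefficient
outside `I` is a unit), of Weierstrass degree `n`. Then `g = f · h` with `f ∈ A[X]` distinguished
at `I` (monic, all lower coefficients in `I`) of degree `n` and `h` a unit of `A⟦X⟧`.
(Local case: Mathlib's `PowerSeries.exists_isWeierstrassFactorization`, Washington Thm. 7.3;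
used over the `p`-adic completion `R̂` of `ℤ[1/6][A₄,A₆][1/H]` in Blakestad–Grant, Lemma 12.)
[folklore] -/
theorem exists_isWeierstrassFactorizationAt [IsAdicComplete I A] {g : A⟦X⟧}
    (hg : g.IsWeierstrassDivisorAt I) (hI : I ≠ ⊤) :
    ∃ (f : A[X]) (h : A⟦X⟧), g.IsWeierstrassFactorizationAt f h I ∧
      f.natDegree = (g.map (Ideal.Quotient.mk I)).order.toNat :=
  ⟨_, _, isWeierstrassFactorizationAt_of_isWeierstrassDivisionAt hg hI
    (hg.isWeierstrassDivisionAt_div_mod _),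
    (isWeierstrassFactorizationAt_of_isWeierstrassDivisionAt hg hI
      (hg.isWeierstrassDivisionAt_div_mod _)).natDegree_eq_toNat_order_map_of_ne_top hI⟩

/-! ### Weierstrass preparation: uniqueness -/

/-- A Weierstrass factorization `g = f · h` yields the Weierstrass division
`Xⁿ = g · h⁻¹ + (Xⁿ - f)` (`n = deg f` = the Weierstrass degree of `g`; `I ≠ A`).
(Mathlib's `IsWeierstrassFactorization.isWeierstrassDivision` is the local case.) [folklore] -/
theorem isWeierstrassDivisionAt_of_isWeierstrassFactorizationAt {g : A⟦X⟧} {f : A[X]} {h : A⟦X⟧}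
    (H : g.IsWeierstrassFactorizationAt f h I) (hI : I ≠ ⊤) :
    (X ^ (g.map (Ideal.Quotient.mk I)).order.toNat).IsWeierstrassDivisionAt g ↑H.isUnit.unit⁻¹
      (Polynomial.X ^ (g.map (Ideal.Quotient.mk I)).order.toNat - f) I := by
  haveI : Nontrivial A :=
    ⟨⟨1, 0, fun h10 => hI ((Ideal.eq_top_iff_one I).mpr (by rw [h10]; exact I.zero_mem))⟩⟩
  set n := (g.map (Ideal.Quotient.mk I)).order.toNat with hn
  constructor
  · refine (Polynomial.degree_sub_lt ?_ (Polynomial.monic_X_pow n).ne_zero ?_).trans_eq (by simpa)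
    · simp_rw [H.degree_eq_coe_lift_order_map_of_ne_top hI, Polynomial.degree_X_pow, n,
        ENat.lift_eq_toNat_of_lt_top]
    · rw [(Polynomial.monic_X_pow n).leadingCoeff, H.isDistinguishedAt.monic.leadingCoeff]
  · simp_rw [H.eq_mul, mul_assoc, IsUnit.mul_val_inv, mul_one, Polynomial.coe_sub,
      Polynomial.coe_pow, Polynomial.coe_X, add_sub_cancel]

/-- **Uniqueness in the Weierstrass preparation theorem** over an `I`-adically separated ring:
if `g` is a Weierstrass divisor at `I ≠ A` and `g = f · h = f' · h'` are two Weierstrass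
factorizations at `I`, then `f = f'` and `h = h'` (both give Weierstrass divisions of `Xⁿ` by
`g`, which are unique: Mathlib's `IsWeierstrassDivisorAt.eq_of_mul_add_eq_mul_add`).
(Local case: Mathlib's `PowerSeries.IsWeierstrassFactorization.elim`.) [folklore] -/
theorem IsWeierstrassFactorizationAt.unique_of_isWeierstrassDivisorAt [IsHausdorff I A]
    {g : A⟦X⟧} {f f' : A[X]} {h h' : A⟦X⟧} (hg : g.IsWeierstrassDivisorAt I) (hI : I ≠ ⊤)
    (H : g.IsWeierstrassFactorizationAt f h I) (H' : g.IsWeierstrassFactorizationAt f' h' I) :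
    f = f' ∧ h = h' := by
  have D := isWeierstrassDivisionAt_of_isWeierstrassFactorizationAt H hI
  have D' := isWeierstrassDivisionAt_of_isWeierstrassFactorizationAt H' hI
  obtain ⟨h1, h2⟩ := hg.eq_of_mul_add_eq_mul_add D.degree_lt D'.degree_lt
    (D.eq_mul_add.symm.trans D'.eq_mul_add)
  rw [← Units.ext_iff, inv_inj, Units.ext_iff] at h1
  exact ⟨by simpa using h2, h1⟩

/-- Under completeness the divisor hypothesis is automatic: **if `g = f · h` is a Weierstrass
factorization at `I ≠ A` over an `I`-adically complete ring, then `g` is a Weierstrass divisor at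
`I`** (its coefficient in the Weierstrass degree `n = deg f` is `≡ h(0)`, a unit modulo
`I ⊆ Jac(A)`), so the factorization is the unique one. [folklore] -/
theorem isWeierstrassDivisorAt_of_isWeierstrassFactorizationAt [IsAdicComplete I A]
    {g : A⟦X⟧} {f : A[X]} {h : A⟦X⟧} (H : g.IsWeierstrassFactorizationAt f h I) (hI : I ≠ ⊤) :
    g.IsWeierstrassDivisorAt I := by
  set n := (g.map (Ideal.Quotient.mk I)).order.toNat with hn
  have hfn : f.natDegree = n := H.natDegree_eq_toNat_order_map_of_ne_top hI
  haveI := isLocalHom_of_le_jacobson_bot I (IsAdicComplete.le_jacobson_bot I)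
  rw [IsWeierstrassDivisorAt]
  refine isUnit_of_map_unit (Ideal.Quotient.mk I) _ ?_
  -- modulo `I`: `ḡ = Xⁿ · h̄`, so `[Xⁿ]ḡ = h̄(0)`
  have hmap : g.map (Ideal.Quotient.mk I) = X ^ n * h.map (Ideal.Quotient.mk I) := by
    rw [H.eq_mul, map_mul, ← Polynomial.polynomial_map_coe, H.isDistinguishedAt.map_eq_X_pow, hfn,
      Polynomial.coe_pow, Polynomial.coe_X]
  have hcoeff : Ideal.Quotient.mk I (coeff n g) = Ideal.Quotient.mk I (constantCoeff h) := by
    rw [← coeff_map, hmap, coeff_X_pow_mul', if_pos le_rfl, Nat.sub_self,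
      coeff_zero_eq_constantCoeff_apply, ← coeff_zero_eq_constantCoeff_apply, coeff_map,
      coeff_zero_eq_constantCoeff_apply]
  rw [hcoeff]
  exact (isUnit_iff_constantCoeff.mp H.isUnit).map _

/-- **Weierstrass preparation, existence and uniqueness packaged**: over an `I`-adically complete
ring, a Weierstrass divisor at `I ≠ A` has exactly one Weierstrass factorization.
[folklore] -/
theorem existsUnique_isWeierstrassFactorizationAt [IsAdicComplete I A] {g : A⟦X⟧}
    (hg : g.IsWeierstrassDivisorAt I) (hI : I ≠ ⊤) :
    ∃! fh : A[X] × A⟦X⟧, g.IsWeierstrassFactorizationAt fh.1 fh.2 I := by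
  obtain ⟨f, h, H, -⟩ := exists_isWeierstrassFactorizationAt hg hI
  refine ⟨(f, h), H, fun fh' H' => ?_⟩
  obtain ⟨h1, h2⟩ := IsWeierstrassFactorizationAt.unique_of_isWeierstrassDivisorAt hg hI H' H
  exact Prod.ext h1 h2

end Literature.RingTheory.HenselLemma
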